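/-
Origin: expansion seat `planner-pub-hodgecm-pv06-g7-0`, handover #1b (CLAIM 2026-08-18T15:11:19Z as part of the row-1 split; HANDOVER #1b = #1 v2 2026-08-18T15:22:10Z) md5 6263d52cd2cc249aa1c79dd437a6f773 (382 l.); additive KERNEL leaf (node N29 / seam S4: records ArchC.HypOrbitSide / ArchC.HypSmoothSide with ONE direction per Sigma12 place -> pv06-g6 OrbitCore; end-state HypSmoothCore12/34, Open_occ_of_hypSmoothCores, N29_occ_of_hypSmoothCores); imports Pv06g7 (`HOME/pub-hodgecm-pv06-g7/lean/Pv06g7/ArchCHyperbolicSide.lean`, md5 6263d52c, 382 lines);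
landed by the gen-8 packager in gate run 31 as `HodgeCM/PerL34/ArchCHyperbolicSide.lean` (import ^import Pv06g7\.ArchCHyperbolic[ \t]*$→import HodgeCM.PerL34.ArchCHyperbolic ×1).
-/
/-
Copyright (c) 2026. Released under the Apache-2.0 license.
-/
import Summits.HodgeConjecture.HodgeCM.PerL34.ArchCHyperbolic

/-!
# One real hyperbolic direction per `Σ₁₂` place — the side records and the end state (node N29, seam S4)

Origin: expansion seat `planner-pub-hodgecm-pv06-g7-0` (unit `pub-hodgecm-pv06-g7`, DAG-node prover #06 gen 7).
WIP module `Pv06g7.ArchCHyperbolicSide`; intended final place `HodgeCM/PerL34/ArchCHyperbolicSide.lean`.  ONE import: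
this seat's `Pv06g7.ArchCHyperbolic` (↦ `HodgeCM.PerL34.ArchCHyperbolic`, ONE rewrite; it carries the tree module
`HodgeCM.PerL34.PrintedSmoothEndState` = pv11-g9 r30 and everything below it).  Sequel of `ArchCHyperbolic.lean`
(§1–§3, §6 there: the hyperbolic element `X₁ = E₀₁ + E₁₀ ∈ 𝔲(1,1)`, its printed Fock operator `printedHyp λ`,
generation of `ℂ[P]` under that ONE operator, the joint family `hypX` on pv12-g7's printed places with
`isGeneratedBy_hypX` / `hyp_gen_format`); split only to keep both files in the tree shape (≤ 400 lines).  Asserts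
nothing: no constants of kind `axiom`, no `Fact_*`/`Open_*` definitions, complete proofs; nothing landed is restated
or edited — pv06-g6 `ArchC.OrbitCore`, pv11-g9 `OpOrbitSide` / `LinSmoothSide` / `PrintedSmoothEndState` are CALLED.

Node N29 = PerL v5 Lemma 4.1(c), tex ll. 488–490 (quoted in `ArchCHyperbolic.lean`); the differentiation step l. 517.

## What is proved (KERNEL, zero hypotheses beyond the binders; nothing cited enters as a hypothesis)

* §4 the records: **`ArchC.HypOrbitSide C P RP kind lam hlam vac ιT`** = pv11-g9's eleven-field `OpOrbitSide` with the
  three fields `ιR`, `XR`, `ladder_span` DELETED and `e`, `hF` re-indexed by `(b : RP) × HypIdx (kind b)` with the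
  direction operator FIXED to `hypX ⟨b, u⟩` (eight fields; `toOrbitCore`, `eigen_of_detected`, `occ_of_wOccurs`,
  `occLeaf` exactly as for `OpOrbitSide`, with `gen := hyp_gen_format`); **`ArchC.HypSmoothSide … [AddCommGroup SK]
  [Module ℂ SK]`** = pv11-g9's nine-field `LinSmoothSide` likewise reduced to SIX fields (`FinIdx`, `ins`, `dense`,
  `omg_ins`, `e`, `smooth`), `toOp` via pv11-g9's `hasDerivAt_pointFunctional_of_tendsto_slope` / `opDense_of_dense`.
* §5 on the END STATE (pv11-g9's vocabulary, verbatim shapes): `HypSmoothCore12/34`, `H_occ`,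
  **`Open_occ_of_hypSmoothCores`**, `N29_occ_of_hypSmoothCores` — `Open_occ` / the carver's `N29_occ` of the end-state
  theta model from, per good context and pair, a kind map, scalings and SIX 𝒯-free fields whose only analytic clause is
  ONE Schwartz-topology derivative per place of type `Σ₁₂`.

Labels.  KERNEL: everything below.  PRINT (unchanged, not used as a hypothesis): that the polynomial model with the
operators `fockOp` IS `ω_{W,b}` (pv12-g6 (P1)(P3), [Ad07] = Adams 2007).  PerL, QW8 and every 2001-programme text are
NOT cited as facts — PerL is the thing under adjudication; its line numbers locate the node, nothing more.
-/

set_option autoImplicit false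

noncomputable section

open scoped Topology
open Filter

namespace HodgeCM
namespace PerL34

/-! ## §4  The side records with ONE direction per `Σ₁₂` place -/

namespace ArchC

open HodgeCM.Prior.Perl34File HodgeCM.Prior.Perl34File.Perl34
open HodgeCM.PerL34.Fock HodgeCM.PerL34.Fock.PrintDict

section Hyp

variable {H HG CG G SK SigIdx SigIdxG : Type*}
variable [NormedAddCommGroup H] [InnerProductSpace ℂ H] [CompleteSpace H]
variable [NormedAddCommGroup HG] [InnerProductSpace ℂ HG] [CompleteSpace HG]
variable [NormedAddCommGroup CG] [NormedSpace ℂ CG]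
variable [Group G] [TopologicalSpace G] [TopologicalSpace SK]

/-- **The D7-free OPERATOR-SIDE printed side with ONE real direction per `Σ₁₂` place** = pv11-g9's `OpOrbitSide` with
`ιR`, `XR`, `ladder_span` deleted and the direction operators FIXED to the hyperbolic slot operators `hypX`: EIGHT
fields; the first six verbatim. -/
structure HypOrbitSide (C : IsolationCore H HG CG G SK SigIdx SigIdxG) (P : C4a.PointedCore C)
    (RP : Type) [Fintype RP] [DecidableEq RP] (kind : RP → PlaceKind) (lam : RP → ℂ)
    (hlam : ∀ b, lam b ≠ 0) (vac : RP → (Circle × Circle →* Circle))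
    (ιT : (printPlaces RP kind lam hlam vac).Tg →* G) where
  /-- [SETUP D4] index of the fixed data at the other places: Φ_f ∈ 𝒮((V₃⊗W)(𝔸_f)). -/
  FinIdx : Type
  /-- [SETUP D4] the pure tensor φ ↦ φ ⊗ Φ_f ∈ 𝒮^κ (bare map). -/
  ins : FinIdx → (printPlaces RP kind lam hlam vac).F → SK
  /-- [SETUP D4] φ ↦ 𝒯_{φ⊗Φ_f} is additive (as operators L²([U(W)]) → C([G_U])). -/
  ins_add : ∀ (f : FinIdx) (φ ψ : (printPlaces RP kind lam hlam vac).F),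
    C.TΦc (ins f (φ + ψ)) = C.TΦc (ins f φ) + C.TΦc (ins f ψ)
  /-- [SETUP D4] φ ↦ 𝒯_{φ⊗Φ_f} is homogeneous. -/
  ins_smul : ∀ (f : FinIdx) (c : ℂ) (φ : (printPlaces RP kind lam hlam vac).F),
    C.TΦc (ins f (c • φ)) = c • C.TΦc (ins f φ)
  /-- [SETUP D4/D5] operator-side density: `𝒯_Φ` is an operator-norm limit of ℂ-combinations of the `𝒯_{φ⊗Φ_f}`. -/
  op_dense : ∀ Φ : SK, C.TΦc Φ ∈ (Submodule.span ℂ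
    (Set.range fun q : FinIdx × (printPlaces RP kind lam hlam vac).F => C.TΦc (ins q.1 q.2))).topologicalClosure
  /-- [SETUP D4] ω(t)(φ ⊗ Φ_f) = (ω_∞(t)φ) ⊗ Φ_f (printed scalings, PINNED vacuum characters). -/
  omg_ins : ∀ (f : FinIdx) (t : (printPlaces RP kind lam hlam vac).Tg) (φ : (printPlaces RP kind lam hlam vac).F),
    C.omg (ιT t) (ins f φ) = ins f ((printPlaces RP kind lam hlam vac).ωT t φ)
  /-- [SETUP D4] at each place `b` of type `Σ₁₂` ONE curve `e_b : ℝ → U(W)(𝔸)` (intended `s ↦ exp(s X₁^{(b)})`,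
  `X₁ = E₀₁ + E₁₀ ∈ 𝔲(W_b) ≅ 𝔲(1,1)` the hyperbolic element, `hypMat_mem_u11`; only the derivative datum `hF` is
  consumed); NO curve at the places of type `D₁₂`, `ι₁` (index `PEmpty`). -/
  e : (b : RP) → HypIdx (kind b) → ℝ → G
  /-- [SETUP D5′] s ↦ 𝒯_{ω(e_b s)(φ⊗Φ_f)}(·)(g) has derivative 𝒯_{(H^{(b)}φ)⊗Φ_f}(·)(g) at 0 in operator norm, `H^{(b)}` =
  the printed Fock operator of `X₁` in slot `b` (`hypX`) — i.e. s ↦ ω(e_b s)(φ⊗Φ_f) is differentiable at 0 in the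
  topology of 𝒮^κ in which Φ ↦ 𝒯_Φ(·)(g) is continuous (Schwartz / Fréchet, NOT L²): Poulsen 1972 Prop. 1.2 (p. 93) +
  the identification of Goodman's D_∞ topology on 𝒮 with the Schwartz topology (adv2g35-O14-R: Folland 1989 p. 165 +
  Reed–Simon I App. to §V.3 Lemmas 1–2 / Thm. V.13 pp. 141–143 + Poulsen Thm. 1.2 p. 93 + Folland Thm. (4.45));
  Folland (4.45)/(4.49) for the VALUE dω(X₁).  ONE such statement per `Σ₁₂` place; `exp(sX₁)` acts in a Schrödinger
  model by a LINEAR FLOW (§6; pv14-g6 `SchwartzLinearFlowDeriv`). -/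
  hF : ∀ (b : RP) (u : HypIdx (kind b)) (f : FinIdx) (φ : (printPlaces RP kind lam hlam vac).F) (p : P.Pt),
    HasDerivAt (fun s : ℝ => C4a.pointFunctional C P (C.omg (e b u s) (ins f φ)) p)
      (C4a.pointFunctional C P (ins f (hypX RP kind lam hlam vac ⟨b, u⟩ φ)) p) 0

namespace HypOrbitSide

variable {C : IsolationCore H HG CG G SK SigIdx SigIdxG} {P : C4a.PointedCore C}
variable {RP : Type} [Fintype RP] [DecidableEq RP] {kind : RP → PlaceKind} {lam : RP → ℂ} {hlam : ∀ b, lam b ≠ 0}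
  {vac : RP → (Circle × Circle →* Circle)} {ιT : (printPlaces RP kind lam hlam vac).Tg →* G}

/-- **pv06-g6's D-free, D7-free chart `OrbitCore C P` for the PRINTED torus from the hyperbolic operator side plus N21**
(`hinv`): `ιX := Σ b, HypIdx (kind b)`, `X := hypX`, `w := printPlacesW`, `pure_detect` := pv11-g9
`pure_detect_of_opDense`, `orbit_stable` := pv06-g6 `orbit_stable_of_hasDerivAt` from `hF`, **`gen := hyp_gen_format`
(§3, KERNEL; no `ladder_span`)**, `φ₀_eigen` := pv12 `ωT_φ₀` + pv12-g7 `printPlacesW_loc`. -/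
def toOrbitCore (A : HypOrbitSide C P RP kind lam hlam vac ιT)
    (hinv : ∀ (h : G) (Φ : SK) (v : H), C.TΦc (C.omg h Φ) (C.R h v) = C.TΦc Φ v) : OrbitCore C P where
  F := (printPlaces RP kind lam hlam vac).F
  ιX := HypDir RP kind
  X := hypX RP kind lam hlam vac
  Tg := (printPlaces RP kind lam hlam vac).Tg
  ιT := ιT
  w := printPlacesW RP kind lam hlam vac
  w_norm := printPlacesW_norm RP kind lam hlam vac
  ωT := (printPlaces RP kind lam hlam vac).ωT
  FinIdx := A.FinIdx
  ins := A.ins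
  φ₀ := (printPlaces RP kind lam hlam vac).φ₀
  ins_add := A.ins_add
  ins_smul := A.ins_smul
  omg_ins := A.omg_ins
  invariance := hinv
  pure_detect := pure_detect_of_opDense A.ins A.op_dense
  orbit_stable := orbit_stable_of_hasDerivAt A.ins (fun j φ => hypX RP kind lam hlam vac j φ) (fun j => A.e j.1 j.2)
    fun j => A.hF j.1 j.2
  gen := hyp_gen_format RP kind lam hlam vac
  φ₀_eigen := fun t => by rw [(printPlaces RP kind lam hlam vac).ωT_φ₀, printPlacesW_loc RP kind lam hlam vac]

/-- Read-back (`rfl`): the chart's operator family IS the hyperbolic slot family. -/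
theorem toOrbitCore_X (A : HypOrbitSide C P RP kind lam hlam vac ιT)
    (hinv : ∀ (h : G) (Φ : SK) (v : H), C.TΦc (C.omg h Φ) (C.R h v) = C.TΦc Φ v) :
    (A.toOrbitCore hinv).X = hypX RP kind lam hlam vac := rfl

/-- Read-back (`rfl`): the chart's torus map IS `ιT`. -/
theorem toOrbitCore_ιT (A : HypOrbitSide C P RP kind lam hlam vac ιT)
    (hinv : ∀ (h : G) (Φ : SK) (v : H), C.TΦc (C.omg h Φ) (C.R h v) = C.TΦc Φ v) :
    (A.toOrbitCore hinv).ιT = ιT := rfl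

/-- Read-back (`rfl`): the chart's character IS the printed weight. -/
theorem toOrbitCore_w (A : HypOrbitSide C P RP kind lam hlam vac ιT)
    (hinv : ∀ (h : G) (Φ : SK) (v : H), C.TΦc (C.omg h Φ) (C.R h v) = C.TΦc Φ v) :
    (A.toOrbitCore hinv).w = printPlacesW RP kind lam hlam vac := rfl

/-- Read-back (`rfl`): the chart's pure tensors ARE `ins`. -/
theorem toOrbitCore_ins (A : HypOrbitSide C P RP kind lam hlam vac ιT)
    (hinv : ∀ (h : G) (Φ : SK) (v : H), C.TΦc (C.omg h Φ) (C.R h v) = C.TΦc Φ v) :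
    (A.toOrbitCore hinv).ins = A.ins := rfl

/-- **Detected ⊆ Eigen for the printed torus, one direction per `Σ₁₂` place** (pv06-g6 `OrbitCore.eigen_of_detected`). -/
theorem eigen_of_detected (A : HypOrbitSide C P RP kind lam hlam vac ιT)
    (hinv : ∀ (h : G) (Φ : SK) (v : H), C.TΦc (C.omg h Φ) (C.R h v) = C.TΦc Φ v)
    (Φ : SK) (i : SigIdx) (h : ∃ v ∈ C.hatσ i, C.TΦ Φ v ≠ 0) :
    ∃ y ∈ C.hatσ i, y ≠ 0 ∧ ∀ t : (printPlaces RP kind lam hlam vac).Tg,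
      C.R (ιT t) y = printPlacesW RP kind lam hlam vac t • y :=
  (A.toOrbitCore hinv).eigen_of_detected Φ i h

/-- **Lemma 4.1(c) in `H_occ` shape for any occurrence predicate `W` that reads printed eigenvectors.** -/
theorem occ_of_wOccurs (A : HypOrbitSide C P RP kind lam hlam vac ιT)
    (hinv : ∀ (h : G) (Φ : SK) (v : H), C.TΦc (C.omg h Φ) (C.R h v) = C.TΦc Φ v)
    {W : SigIdx → Prop}
    (hW : ∀ i : SigIdx, (∃ y ∈ C.hatσ i, y ≠ 0 ∧ ∀ t : (printPlaces RP kind lam hlam vac).Tg,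
      C.R (ιT t) y = printPlacesW RP kind lam hlam vac t • y) → W i) :
    ∀ (Φ : SK) (i : SigIdx), (∃ v ∈ C.hatσ i, C.TΦ Φ v ≠ 0) → W i :=
  fun Φ i h => hW i (A.eigen_of_detected hinv Φ i h)

/-- … hence the S4 leaf `OccLeaf C D` for any torus datum whose `wOccurs` reads printed eigenvectors (pv06-g6
`OrbitCore.occLeaf`). -/
theorem occLeaf (A : HypOrbitSide C P RP kind lam hlam vac ιT)
    (hinv : ∀ (h : G) (Φ : SK) (v : H), C.TΦc (C.omg h Φ) (C.R h v) = C.TΦc Φ v) (D : TorusData C)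
    (hD : ∀ i : SigIdx, (∃ y ∈ C.hatσ i, y ≠ 0 ∧ ∀ t : (printPlaces RP kind lam hlam vac).Tg,
      C.R (ιT t) y = printPlacesW RP kind lam hlam vac t • y) → D.wOccurs i) :
    OccLeaf C D :=
  (A.toOrbitCore hinv).occLeaf D hD

end HypOrbitSide

/-- **The 𝒯-free D7-free LINEAR printed side with ONE real direction per `Σ₁₂` place** = pv11-g9's nine-field
`LinSmoothSide` with `ιR`, `XR`, `ladder_span` deleted and the direction operators fixed to `hypX`: SIX fields over a
ℂ-vector-space structure on `𝒮^κ` given as instance parameters; every field speaks of (ω, 𝒮^κ, the printed Fock data)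
only, and the one analytic clause `smooth` is ONE Schwartz-topology derivative per `Σ₁₂` place. -/
structure HypSmoothSide (C : IsolationCore H HG CG G SK SigIdx SigIdxG) (P : C4a.PointedCore C)
    (RP : Type) [Fintype RP] [DecidableEq RP] (kind : RP → PlaceKind) (lam : RP → ℂ)
    (hlam : ∀ b, lam b ≠ 0) (vac : RP → (Circle × Circle →* Circle))
    (ιT : (printPlaces RP kind lam hlam vac).Tg →* G) [AddCommGroup SK] [Module ℂ SK] where
  /-- [SETUP D4] index of the fixed data at the other places: Φ_f ∈ 𝒮((V₃⊗W)(𝔸_f)). -/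
  FinIdx : Type
  /-- [SETUP D4] the pure tensor φ ↦ φ ⊗ Φ_f ∈ 𝒮^κ, linear in φ. -/
  ins : FinIdx → (printPlaces RP kind lam hlam vac).F →ₗ[ℂ] SK
  /-- [SETUP D4/D5] the pure tensors span a dense subspace of 𝒮^κ. -/
  dense : Dense (Submodule.span ℂ
    (Set.range fun q : FinIdx × (printPlaces RP kind lam hlam vac).F => ins q.1 q.2) : Set SK)
  /-- [SETUP D4] ω(t)(φ ⊗ Φ_f) = (ω_∞(t)φ) ⊗ Φ_f (printed scalings, PINNED vacuum characters). -/
  omg_ins : ∀ (f : FinIdx) (t : (printPlaces RP kind lam hlam vac).Tg) (φ : (printPlaces RP kind lam hlam vac).F),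
    C.omg (ιT t) (ins f φ) = ins f ((printPlaces RP kind lam hlam vac).ωT t φ)
  /-- [SETUP D4] at each place of type `Σ₁₂` ONE curve `e_b : ℝ → U(W)(𝔸)` (intended `exp(s X₁^{(b)})`); none else. -/
  e : (b : RP) → HypIdx (kind b) → ℝ → G
  /-- [SETUP D5′, FRÉCHET-SMOOTH VECTOR — ω alone: no 𝒯, no σ̂, no L²] at each `Σ₁₂` place: φ⊗Φ_f is a C¹ vector of ω
  along `e_b` with derivative (H^{(b)}φ)⊗Φ_f IN THE TOPOLOGY OF 𝒮^κ, `H^{(b)}` the printed Fock operator of `X₁` in slot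
  `b`: s⁻¹(ω(e_b s)(φ⊗Φ_f) − ω(e_b 0)(φ⊗Φ_f)) → (H^{(b)}φ)⊗Φ_f as s → 0, s ≠ 0.  PRINT WARRANT as for
  `LinSmoothSide.smooth` (Poulsen 1972 Prop. 1.2 p. 93 + adv2g35-O14-R topology identification; Folland (4.45)/(4.49)
  for the VALUE only).  `exp(sX₁)` is a LINEAR FLOW in a Schrödinger model (§6). -/
  smooth : ∀ (b : RP) (u : HypIdx (kind b)) (f : FinIdx) (φ : (printPlaces RP kind lam hlam vac).F),
    Tendsto (fun s : ℝ => ((s : ℝ) : ℂ)⁻¹ • (C.omg (e b u s) (ins f φ) - C.omg (e b u 0) (ins f φ)))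
      (𝓝[≠] 0) (𝓝 (ins f (hypX RP kind lam hlam vac ⟨b, u⟩ φ)))

namespace HypSmoothSide

variable [AddCommGroup SK] [Module ℂ SK] {C : IsolationCore H HG CG G SK SigIdx SigIdxG} {P : C4a.PointedCore C}
variable {RP : Type} [Fintype RP] [DecidableEq RP] {kind : RP → PlaceKind} {lam : RP → ℂ} {hlam : ∀ b, lam b ≠ 0}
  {vac : RP → (Circle × Circle →* Circle)} {ιT : (printPlaces RP kind lam hlam vac).Tg →* G}

/-- **`smooth ⇒ hF`, `dense ⇒ op_dense`**: the eight-field operator side from the six-field 𝒯-free one plus the two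
linearity laws and the operator-norm continuity of Φ ↦ 𝒯_Φ (pv11-g9 `hasDerivAt_pointFunctional_of_tendsto_slope`,
`opDense_of_dense`). -/
def toOp (A : HypSmoothSide C P RP kind lam hlam vac ιT)
    (TΦc_add : ∀ Φ Ψ : SK, C.TΦc (Φ + Ψ) = C.TΦc Φ + C.TΦc Ψ)
    (TΦc_smul : ∀ (c : ℂ) (Φ : SK), C.TΦc (c • Φ) = c • C.TΦc Φ)
    (hTc : Continuous fun Φ : SK => C.TΦc Φ) : HypOrbitSide C P RP kind lam hlam vac ιT where
  FinIdx := A.FinIdx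
  ins := fun f φ => A.ins f φ
  ins_add := fun f φ ψ => by
    show C.TΦc (A.ins f (φ + ψ)) = C.TΦc (A.ins f φ) + C.TΦc (A.ins f ψ)
    rw [map_add, TΦc_add]
  ins_smul := fun f c φ => by
    show C.TΦc (A.ins f (c • φ)) = c • C.TΦc (A.ins f φ)
    rw [LinearMap.map_smul, TΦc_smul]
  op_dense := opDense_of_dense TΦc_add TΦc_smul hTc (fun f φ => A.ins f φ) A.dense
  omg_ins := A.omg_ins
  e := A.e
  hF := fun b u f φ p => hasDerivAt_pointFunctional_of_tendsto_slope TΦc_add TΦc_smul hTc (A.smooth b u f φ) p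

/-- Read-back (`rfl`): the pure tensors of the derived side ARE `ins`. -/
theorem toOp_ins (A : HypSmoothSide C P RP kind lam hlam vac ιT)
    (TΦc_add : ∀ Φ Ψ : SK, C.TΦc (Φ + Ψ) = C.TΦc Φ + C.TΦc Ψ)
    (TΦc_smul : ∀ (c : ℂ) (Φ : SK), C.TΦc (c • Φ) = c • C.TΦc Φ)
    (hTc : Continuous fun Φ : SK => C.TΦc Φ) (f : A.FinIdx) (φ : (printPlaces RP kind lam hlam vac).F) :
    (A.toOp TΦc_add TΦc_smul hTc).ins f φ = A.ins f φ := rfl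

/-- **Detected ⊆ Eigen for the printed torus from the six 𝒯-free fields** (plus the linearity laws, operator-norm
continuity and N21). -/
theorem eigen_of_detected (A : HypSmoothSide C P RP kind lam hlam vac ιT)
    (TΦc_add : ∀ Φ Ψ : SK, C.TΦc (Φ + Ψ) = C.TΦc Φ + C.TΦc Ψ)
    (TΦc_smul : ∀ (c : ℂ) (Φ : SK), C.TΦc (c • Φ) = c • C.TΦc Φ)
    (hTc : Continuous fun Φ : SK => C.TΦc Φ)
    (hinv : ∀ (h : G) (Φ : SK) (v : H), C.TΦc (C.omg h Φ) (C.R h v) = C.TΦc Φ v)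
    (Φ : SK) (i : SigIdx) (h : ∃ v ∈ C.hatσ i, C.TΦ Φ v ≠ 0) :
    ∃ y ∈ C.hatσ i, y ≠ 0 ∧ ∀ t : (printPlaces RP kind lam hlam vac).Tg,
      C.R (ιT t) y = printPlacesW RP kind lam hlam vac t • y :=
  (A.toOp TΦc_add TΦc_smul hTc).eigen_of_detected hinv Φ i h

end HypSmoothSide

end Hyp

end ArchC
end PerL34

/-! ## §5  On the END STATE: `Open_occ` from six 𝒯-free fields per context and pair -/

namespace Universe

namespace AdelicTorusCore

open HodgeCM.PerL34 HodgeCM.PerL34.ArchC HodgeCM.PerL34.Fock HodgeCM.PerL34.Fock.PrintDict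
open HodgeCM.Prior.Perl34File HodgeCM.Prior.Perl34File.Perl34
open NumberField NumberField.SeesawArchTorus

variable {U : Universe} {hP : PrintFact_unitaryCompact} (C : U.AdelicTorusCore hP)
  (R12 : ∀ {L : CMField} {ι₁ : L →+* ℂ} (V : HermSpace3 L ι₁) (c : SeesawCtx L), C.Rest12 V c)
  (R34 : ∀ {L : CMField} {ι₁ : L →+* ℂ} (V : HermSpace3 L ι₁) (c : SeesawCtx L), C.Rest34 V c)
  (hA : (C.rtc R12 R34).Analytic)

section OpenOcc

/-- **The (12) 𝒯-free HYPERBOLIC printed core of a context on the END STATE of a linear Weil theta model**: a kind map,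
scalings, and a six-field `HypSmoothSide` over `T∘.core V c` at the canonical points and the canonical (12) chart. -/
structure HypSmoothCore12 {L : CMField} {ι₁ : L →+* ℂ} (V : HermSpace3 L ι₁) (c : SeesawCtx L)
    [ℓ : (C.wm V c).LinearStr] where
  /-- decidable equality of the infinite places (any instance; used only to form the printed places) -/
  [decEq : DecidableEq (InfinitePlace (L : Type))]
  /-- the kind `Σ₁₂ / D₁₂ / ι₁` of each infinite place -/
  kind : InfinitePlace (L : Type) → PlaceKind
  /-- the printed scalings `λ_b ≠ 0` -/
  lam : InfinitePlace (L : Type) → ℂ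
  hlam : ∀ w, lam w ≠ 0
  /-- the six-field 𝒯-free hyperbolic side at the canonical points and the canonical (12) chart -/
  side : HypSmoothSide ((ThetaModel.ofRegCarrier (C.rtc R12 R34) hA).core V c) (C.pointedCore R12 R34 hA V c)
    (InfinitePlace (L : Type)) kind lam hlam (pinnedVacs kind (R12 V c).m₁ (R12 V c).m₂)
    (C.chart12 R12 V c kind lam hlam)

/-- **The (34) 𝒯-free HYPERBOLIC printed core of a context on the END STATE of a linear Weil theta model.** -/
structure HypSmoothCore34 {L : CMField} {ι₁ : L →+* ℂ} (V : HermSpace3 L ι₁) (c : SeesawCtx L)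
    [ℓ : (C.wm V c).LinearStr] where
  [decEq : DecidableEq (InfinitePlace (L : Type))]
  kind : InfinitePlace (L : Type) → PlaceKind
  lam : InfinitePlace (L : Type) → ℂ
  hlam : ∀ w, lam w ≠ 0
  side : HypSmoothSide ((ThetaModel.ofRegCarrier (C.rtc R12 R34) hA).core V c) (C.pointedCore R12 R34 hA V c)
    (InfinitePlace (L : Type)) kind lam hlam (pinnedVacs kind (R34 V c).m₁ (R34 V c).m₂)
    (C.chart34 R34 V c kind lam hlam)

namespace HypSmoothCore12

variable {C R12 R34 hA} {L : CMField} {ι₁ : L →+* ℂ} {V : HermSpace3 L ι₁} {c : SeesawCtx L}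

/-- **Lemma 4.1(c), pair (12), on the END STATE of a linear Weil theta model from the six 𝒯-free fields alone**
(linearity laws := pv11-g9 `TΦc_add_of_linear` / `TΦc_smul_of_linear`, operator-norm continuity := `continuous_TΦc`,
N21 := `invariance`, occurrence := `t12_wOccurs_of_printedEigenvector`); conclusion literally `(T∘.t12 V c).wOccurs i`. -/
theorem H_occ [ℓ : (C.wm V c).LinearStr] (A : HypSmoothCore12 C R12 R34 hA V c) :
    ∀ (Φ : (ThetaModel.ofRegCarrier (C.rtc R12 R34) hA).SK V c)
      (i : (ThetaModel.ofRegCarrier (C.rtc R12 R34) hA).SigIdx V c),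
      (∃ v ∈ ((ThetaModel.ofRegCarrier (C.rtc R12 R34) hA).core V c).hatσ i,
        ((ThetaModel.ofRegCarrier (C.rtc R12 R34) hA).core V c).TΦ Φ v ≠ 0) →
      ((ThetaModel.ofRegCarrier (C.rtc R12 R34) hA).t12 V c).wOccurs i :=
  letI := A.decEq
  (A.side.toOp (C.TΦc_add_of_linear R12 R34 hA V c) (C.TΦc_smul_of_linear R12 R34 hA V c)
      (C.continuous_TΦc R12 R34 hA V c)).occ_of_wOccurs (C.invariance R12 R34 hA V c)
    (C.t12_wOccurs_of_printedEigenvector R12 R34 V c A.kind A.lam A.hlam hA)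

end HypSmoothCore12

namespace HypSmoothCore34

variable {C R12 R34 hA} {L : CMField} {ι₁ : L →+* ℂ} {V : HermSpace3 L ι₁} {c : SeesawCtx L}

/-- **Lemma 4.1(c), pair (34), on the END STATE of a linear Weil theta model from the six 𝒯-free fields alone.** -/
theorem H_occ [ℓ : (C.wm V c).LinearStr] (A : HypSmoothCore34 C R12 R34 hA V c) :
    ∀ (Φ : (ThetaModel.ofRegCarrier (C.rtc R12 R34) hA).SK V c)
      (i : (ThetaModel.ofRegCarrier (C.rtc R12 R34) hA).SigIdx V c),
      (∃ v ∈ ((ThetaModel.ofRegCarrier (C.rtc R12 R34) hA).core V c).hatσ i,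
        ((ThetaModel.ofRegCarrier (C.rtc R12 R34) hA).core V c).TΦ Φ v ≠ 0) →
      ((ThetaModel.ofRegCarrier (C.rtc R12 R34) hA).t34 V c).wOccurs i :=
  letI := A.decEq
  (A.side.toOp (C.TΦc_add_of_linear R12 R34 hA V c) (C.TΦc_smul_of_linear R12 R34 hA V c)
      (C.continuous_TΦc R12 R34 hA V c)).occ_of_wOccurs (C.invariance R12 R34 hA V c)
    (C.t34_wOccurs_of_printedEigenvector R12 R34 V c A.kind A.lam A.hlam hA)

end HypSmoothCore34

/-- **`Open_occ` (N29 = PerL Lemma 4.1(c) / Thm 3.7 (†), BOTH torus sides) of the END-STATE theta model of a core with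
LINEAR Weil theta models, from six 𝒯-FREE fields per good context and pair** (kind + scalings + `HypSmoothSide`):
ONE Schwartz-topology derivative per place of type `Σ₁₂`.  No hypothesis mentions the theta kernel, σ̂, N21, a
continuity of Φ ↦ 𝒯_Φ, a family of real directions or `ladder_span`. -/
theorem Open_occ_of_hypSmoothCores
    (lin : ∀ {L : CMField} {ι₁ : L →+* ℂ} (V : HermSpace3 L ι₁) (c : SeesawCtx L), (C.wm V c).LinearStr)
    (A12 : ∀ {L : CMField} {ι₁ : L →+* ℂ} (V : HermSpace3 L ι₁) (c : SeesawCtx L),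
      (ThetaModel.ofRegCarrier (C.rtc R12 R34) hA).GoodCtx ι₁ c →
        Nonempty (C.HypSmoothCore12 R12 R34 hA V c (ℓ := lin V c)))
    (A34 : ∀ {L : CMField} {ι₁ : L →+* ℂ} (V : HermSpace3 L ι₁) (c : SeesawCtx L),
      (ThetaModel.ofRegCarrier (C.rtc R12 R34) hA).GoodCtx ι₁ c →
        Nonempty (C.HypSmoothCore34 R12 R34 hA V c (ℓ := lin V c))) :
    (ThetaModel.ofRegCarrier (C.rtc R12 R34) hA).Open_occ :=
  fun V c hc => ⟨fun Φ i h => (A12 V c hc).elim fun A => A.H_occ (ℓ := lin V c) Φ i h,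
    fun Φ i h => (A34 V c hc).elim fun A => A.H_occ (ℓ := lin V c) Φ i h⟩

/-- **N29 BY THE CARVER'S NAME** (`Arch.N29_occ`) on the end state, from the 𝒯-free hyperbolic cores. -/
theorem N29_occ_of_hypSmoothCores
    (lin : ∀ {L : CMField} {ι₁ : L →+* ℂ} (V : HermSpace3 L ι₁) (c : SeesawCtx L), (C.wm V c).LinearStr)
    (A12 : ∀ {L : CMField} {ι₁ : L →+* ℂ} (V : HermSpace3 L ι₁) (c : SeesawCtx L),
      (ThetaModel.ofRegCarrier (C.rtc R12 R34) hA).GoodCtx ι₁ c →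
        Nonempty (C.HypSmoothCore12 R12 R34 hA V c (ℓ := lin V c)))
    (A34 : ∀ {L : CMField} {ι₁ : L →+* ℂ} (V : HermSpace3 L ι₁) (c : SeesawCtx L),
      (ThetaModel.ofRegCarrier (C.rtc R12 R34) hA).GoodCtx ι₁ c →
        Nonempty (C.HypSmoothCore34 R12 R34 hA V c (ℓ := lin V c))) :
    N29_occ (ThetaModel.ofRegCarrier (C.rtc R12 R34) hA) :=
  C.Open_occ_of_hypSmoothCores R12 R34 hA lin A12 A34

end OpenOcc

end AdelicTorusCore

end Universe

end HodgeCM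

end
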